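import Summits.FinalStateConjecture.FinalStateConjecture.Theorems.KerrShieldedDataExist.Negative.BentSliceConormal
import Literature.Analysis.Calculus.SmoothConvexCutoff
import Literature.Analysis.Calculus.SmoothCutoff
import Mathlib.Analysis.SpecialFunctions.SmoothTransition
import Mathlib.Analysis.Calculus.Deriv.MeanValue
import Summits.FinalStateConjecture.FinalStateConjecture.Theorems.SwallowTheDatumKerrShieldedDataExistBridgeProfile
import Summits.FinalStateConjecture.FinalStateConjecture.Theorems.SwallowTheDatumKerrShieldedDataExistBridgeProfileZones
import Summits.FinalStateConjecture.FinalStateConjecture.Theorems.SwallowTheDatumKerrShieldedDataExistBridgeProfileAssembly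
import Mathlib.Analysis.SpecialFunctions.Log.Deriv
import HarnessLib

/-!
# `KerrShieldedDataExist`, line `plug-the-second-sheet` — the bridge annulus, VII: the bridge profile

Support file (everything proved) for stub `stub_bridgeAnnulus` of crux `stmt-FinalStateConjecture-10055`.
`exists_bridgeProfile`: for `M > 0` there are `C^∞` functions `τ, ϱ` on `(0, ∞)` and a constant `c` such that the
radial map `y ↦ (τ(|y|), (ϱ(|y|)/|y|) y)` into the ingoing Schwarzschild chart has `ϱ > 0` and radial
coefficient `A > 0` (spacelike) on `M/40 < |y| < 3M/4`, equals the Boyer–Lindquist leaf `t* = c + T(r)`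
(`T = Negative.bentHeight M 0`) read through the sheet-two isotropic map `r = (2s + M)²/(4s)` for `s < 3M/10`,
and equals the Kerr–Schild graph `t* = 4M log(1 − r/2M)`, `r = s`, for `7M/10 < s < M`. Reading `s` outward the
curve in the `(t*, r)` half-plane of the LEFT ingoing chart runs: bent/BL leaf of the left exterior — left
Kerr–Schild slice `{t* = c}` through the left horizon down to `r ≈ M/2` — rounded corner over `v = t* + r` —
straight segment `t* = 3(M − r)` — graph interpolation onto `t* = 4M log(1 − r/2M)` (the `{t*_R = 0}` slice of the
right chart; O'Neill 1983, Ch. 13). The five zones are those of `…BridgeProfileZones`; positivity of `A` is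
`…BridgeProfile`.
-/

-- the doubled `FinalStateConjecture` path component is the summit/problem naming scheme, not a mistake
set_option linter.dupNamespace false

noncomputable section

open Real Set Filter
open scoped Manifold ContDiff Topology InnerProductSpace
open Literature.Geometry.Lorentzian
open Summit.FinalStateConjecture.FinalStateConjecture.Theorems.KerrShieldedDataExist

namespace Summit.FinalStateConjecture.FinalStateConjecture.Theorems.SwallowTheDatum

namespace Bridge

/-! ### The bridge profile -/

section Exists

variable {M : ℝ}

/-- Values of a smooth step `S(a s + b)` (`a > 0`): `0` for `a s + b ≤ 0`, `1` for `1 ≤ a s + b`, always in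
`[0, 1]`. [folklore] -/
theorem smoothStep_eq_zero {a b s : ℝ} (h : a * s + b ≤ 0) : Real.smoothTransition (a * s + b) = 0 :=
  Real.smoothTransition.zero_of_nonpos h

/-- See `smoothStep_eq_zero`. [folklore] -/
theorem smoothStep_eq_one {a b s : ℝ} (h : 1 ≤ a * s + b) : Real.smoothTransition (a * s + b) = 1 :=
  Real.smoothTransition.one_of_one_le h

/-- The argument of a step `a s/M + b` is nonpositive when `a s ≤ −b M` (`M > 0`). [folklore] -/
theorem step_arg_nonpos (hM : 0 < M) {a b s : ℝ} (h : a * s ≤ -b * M) : a / M * s + b ≤ 0 := by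
  rw [div_mul_eq_mul_div, ← le_sub_iff_add_le, zero_sub, div_le_iff₀ hM]; exact h

/-- The argument of a step `a s/M + b` is at least `1` when `(1 − b) M ≤ a s` (`M > 0`). [folklore] -/
theorem one_le_step_arg (hM : 0 < M) {a b s : ℝ} (h : (1 - b) * M ≤ a * s) : 1 ≤ a / M * s + b := by
  rw [div_mul_eq_mul_div, ← sub_le_iff_le_add, le_div_iff₀ hM]; exact h

/-- **The bridge profile.** For `M > 0` (and the smooth literal height `T = Negative.bentHeight M 0`) there
are `C^∞` functions `τ, ϱ` on `(0, ∞)` and a constant `c` such that the radial map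
`y ↦ (τ(|y|), (ϱ(|y|)/|y|) y)` into the Schwarzschild Kerr–Schild chart is spacelike on the annulus
`M/40 < |y| < 3M/4` (`ϱ > 0` and `A = −τ′² + ϱ′² + (2M/ϱ)(τ′ + ϱ′)² > 0`), is the Boyer–Lindquist leaf
`t* = c + T(r)` read through the sheet-two isotropic map `r = (2s + M)²/(4s)` for `s < 3M/10`, and is the
Kerr–Schild graph `t* = 4M log(1 − r/2M)`, `r = s`, for `7M/10 < s < M`. Reading `s` outward: the BL/bent
leaf of the left ingoing chart down through the left horizon (`T ≡ 0` below `4M`), the left Kerr–Schild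
slice `{t* = c}` descending to `r ≈ M/2`, a rounded corner over `v = t* + r` (`exists_cornerRadius`), the
straight spacelike segment `t* = 3(M − r)` and a graph interpolation onto `t* = 4M log(1 − r/2M)` — the
`{t*_R = 0}` slice of the right chart (O'Neill 1983, Ch. 13: both ingoing charts of the Kruskal plane
carry the same Kerr–Schild form). [cite: ONeill1983, Ch. 13] -/
theorem exists_bridgeProfile (hM : 0 < M) (hT : ContDiff ℝ ∞ (Negative.bentHeight M 0)) :
    ∃ τ ϱ : ℝ → ℝ, ∃ c : ℝ,
      ContDiffOn ℝ ∞ ϱ (Ioi 0) ∧ ContDiffOn ℝ ∞ τ (Ioi 0) ∧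
      (∀ s ∈ Ioo (M / 40) (3 * M / 4), 0 < ϱ s ∧
        0 < -(deriv τ s) ^ 2 + (deriv ϱ s) ^ 2 + 2 * M / ϱ s * (deriv τ s + deriv ϱ s) ^ 2) ∧
      (∀ s ∈ Ioo 0 (3 * M / 10), ϱ s = (2 * s + M) ^ 2 / (4 * s) ∧
        τ s = Negative.bentHeight M 0 ((2 * s + M) ^ 2 / (4 * s)) + c) ∧
      (∀ s ∈ Ioo (7 * M / 10) M, ϱ s = s ∧ τ s = 4 * M * Real.log (1 - s / (2 * M))) := by
  obtain ⟨ϱc, ℓ₀, hcs, hℓ0, hℓ1, hc_lo, hc_hi, hc_der, hc_ge, hc_lt⟩ := exists_cornerRadius hM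
  have h0M : |(0 : ℝ)| < M := by rwa [abs_zero]
  -- the components
  set ρI : ℝ → ℝ := fun s ↦ (2 * s + M) ^ 2 / (4 * s) with hρI
  set χ : ℝ → ℝ := fun s ↦ Real.smoothTransition (10 / M * s + (-3)) with hχ
  set ν : ℝ → ℝ := fun s ↦ Real.smoothTransition (25 / M * s + (-14)) with hν
  set ν₂ : ℝ → ℝ := fun s ↦ Real.smoothTransition (25 / M * s + (-(51 / 4))) with hν₂
  set τh : ℝ → ℝ := fun r ↦ (1 - Real.smoothTransition (10 / M * r + (-6))) * (3 * (M - r)) +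
      Real.smoothTransition (10 / M * r + (-6)) * (4 * M * Real.log
        ((1 - Real.smoothTransition (2 / M * r + (-2))) * (1 - r / (2 * M)) +
          Real.smoothTransition (2 / M * r + (-2)) / 4)) with hτh
  set T : ℝ → ℝ := Negative.bentHeight M 0 with hTdef
  set ϱ : ℝ → ℝ := fun s ↦ (1 - ν s) * ((1 - χ s) * ρI s + χ s * ϱc s) + ν s * s with hϱ
  set τ : ℝ → ℝ := fun s ↦ T (ϱ s) + (1 - ν₂ s) * (51 * M / 20 - s - ϱc s) + ν₂ s * τh (ϱ s) with hτ
  have hϱdef : ∀ s, ϱ s = (1 - ν s) * ((1 - χ s) * ρI s + χ s * ϱc s) + ν s * s := fun s ↦ rfl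
  have hτdef : ∀ s, τ s = T (ϱ s) + (1 - ν₂ s) * (51 * M / 20 - s - ϱc s) + ν₂ s * τh (ϱ s) :=
    fun s ↦ rfl
  -- values of the steps
  have hχ0 : ∀ s, s ≤ 3 * M / 10 → χ s = 0 := fun s hs ↦
    smoothStep_eq_zero (step_arg_nonpos hM (by linarith))
  have hχ1 : ∀ s, 2 * M / 5 ≤ s → χ s = 1 := fun s hs ↦
    smoothStep_eq_one (one_le_step_arg hM (by linarith))
  have hν0 : ∀ s, s ≤ 14 * M / 25 → ν s = 0 := fun s hs ↦
    smoothStep_eq_zero (step_arg_nonpos hM (by linarith))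
  have hν1 : ∀ s, 3 * M / 5 ≤ s → ν s = 1 := fun s hs ↦
    smoothStep_eq_one (one_le_step_arg hM (by linarith))
  have hν₂0 : ∀ s, s ≤ 51 * M / 100 → ν₂ s = 0 := fun s hs ↦
    smoothStep_eq_zero (step_arg_nonpos hM (by linarith))
  have hν₂1 : ∀ s, 11 * M / 20 ≤ s → ν₂ s = 1 := fun s hs ↦
    smoothStep_eq_one (one_le_step_arg hM (by linarith))
  have hχb : ∀ s, 0 ≤ χ s ∧ χ s ≤ 1 := fun s ↦
    ⟨Real.smoothTransition.nonneg _, Real.smoothTransition.le_one _⟩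
  have hνb : ∀ s, 0 ≤ ν s ∧ ν s ≤ 1 := fun s ↦
    ⟨Real.smoothTransition.nonneg _, Real.smoothTransition.le_one _⟩
  have hT4 : ∀ r, r ≤ 4 * M → T r = 0 := fun r hr ↦ Negative.bentHeight_eq_zero_of_le hM hr
  have hτh_line : ∀ r, r ≤ 3 * M / 5 → τh r = 3 * (M - r) := by
    intro r hr
    have hμ : Real.smoothTransition (10 / M * r + (-6)) = 0 :=
      smoothStep_eq_zero (step_arg_nonpos hM (by linarith))
    simp only [hτh, hμ]; ring
  have hτh_out : ∀ r, 7 * M / 10 ≤ r → r ≤ M → τh r = 4 * M * Real.log (1 - r / (2 * M)) := by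
    intro r hr1 hr2
    have hμ : Real.smoothTransition (10 / M * r + (-6)) = 1 :=
      smoothStep_eq_one (one_le_step_arg hM (by linarith))
    have hw : Real.smoothTransition (2 / M * r + (-2)) = 0 :=
      smoothStep_eq_zero (step_arg_nonpos hM (by linarith))
    simp only [hτh, hμ, hw]; ring_nf
  -- elementary bounds on the components
  have hρI2 : ∀ s, 0 < s → 2 * M ≤ ρI s := fun s hs ↦ two_mul_le_rhoIso hs
  have hℓ4 : ℓ₀ ≤ 4 * M := by linarith
  have hc4 : ∀ s, M / 20 ≤ s → s < 3 * M / 4 → ϱc s < M := by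
    intro s hs1 hs2
    refine (hc_lt s).trans_le (max_le ?_ ?_) <;> linarith
  -- smoothness
  have hϱs : ContDiffOn ℝ ∞ ϱ (Ioi 0) := by
    have h1 := (contDiff_smoothStep (25 / M) (-14)).contDiffOn (s := Ioi 0)
    have h2 := (contDiff_smoothStep (10 / M) (-3)).contDiffOn (s := Ioi 0)
    exact ((contDiffOn_const.sub h1).mul (((contDiffOn_const.sub h2).mul contDiffOn_rhoIso).add
      (h2.mul hcs.contDiffOn))).add (h1.mul contDiffOn_id)
  have hτs : ContDiffOn ℝ ∞ τ (Ioi 0) := by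
    have h3 := (contDiff_smoothStep (25 / M) (-(51 / 4))).contDiffOn (s := Ioi 0)
    have hA : ContDiffOn ℝ ∞ (fun s ↦ T (ϱ s)) (Ioi 0) := hT.comp_contDiffOn hϱs
    have hB : ContDiffOn ℝ ∞ (fun s ↦ τh (ϱ s)) (Ioi 0) := (contDiff_tauHat hM).comp_contDiffOn hϱs
    exact (hA.add ((contDiffOn_const.sub h3).mul ((contDiffOn_const.sub contDiffOn_id).sub
      hcs.contDiffOn))).add (h3.mul hB)
  -- Zone 1: `(0, 3M/10)`
  have hZ1 : ∀ s ∈ Ioo 0 (3 * M / 10), (ϱ s = ρI s ∧ τ s = T (ρI s) + (51 * M / 20 - ℓ₀)) ∧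
      0 < ϱ s ∧ 0 < -(deriv τ s) ^ 2 + (deriv ϱ s) ^ 2 + 2 * M / ϱ s * (deriv τ s + deriv ϱ s) ^ 2 := by
    intro s hs
    have hs0 : 0 < s := hs.1
    have hχZ : ∀ t ∈ Ioo 0 (3 * M / 10), χ t = 0 := fun t ht ↦ hχ0 t ht.2.le
    have hνZ : ∀ t ∈ Ioo 0 (3 * M / 10), ν t = 0 := fun t ht ↦ hν0 t (by linarith [ht.2])
    have hν₂Z : ∀ t ∈ Ioo 0 (3 * M / 10), ν₂ t = 0 := fun t ht ↦ hν₂0 t (by linarith [ht.2])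
    have hcZ : ∀ t ∈ Ioo 0 (3 * M / 10), ϱc t = ℓ₀ - t := fun t ht ↦ hc_lo t (by linarith [ht.2])
    have heq := zone1_eq hϱdef hτdef hχZ hνZ hν₂Z hcZ hs
    have hρpos : 0 < ρI s := by have := hρI2 s hs0; linarith
    have hder := zone1_hasDerivAt isOpen_Ioo hϱdef hτdef hχZ hνZ hν₂Z hcZ hs (hasDerivAt_rhoIso hs0.ne')
      (Negative.hasDerivAt_bentHeight h0M (ρI s))
    refine ⟨heq, by rw [heq.1]; exact hρpos, ?_⟩
    rw [hder.1.deriv, hder.2.deriv, heq.1]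
    refine radialA_pos_of_graph hρpos ?_ (Negative.conormalForm_bentSlope_neg h0M hρpos 0)
    have h1 : 2 * s - M < 0 := by linarith [hs.2]
    have h2 : 0 < 2 * s + M := by linarith
    exact (div_neg_of_neg_of_pos (mul_neg_of_neg_of_pos h1 h2) (by positivity)).ne
  -- Zone 2: `(M/4, 9M/20)`
  have hZ2 : ∀ s ∈ Ioo (M / 4) (9 * M / 20),
      0 < ϱ s ∧ 0 < -(deriv τ s) ^ 2 + (deriv ϱ s) ^ 2 + 2 * M / ϱ s * (deriv τ s + deriv ϱ s) ^ 2 := by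
    intro s hs
    have hs0 : 0 < s := by linarith [hs.1]
    have hνZ : ∀ t ∈ Ioo (M / 4) (9 * M / 20), ν t = 0 := fun t ht ↦ hν0 t (by linarith [ht.2])
    have hν₂Z : ∀ t ∈ Ioo (M / 4) (9 * M / 20), ν₂ t = 0 := fun t ht ↦ hν₂0 t (by linarith [ht.2])
    have hcZ : ∀ t ∈ Ioo (M / 4) (9 * M / 20), ϱc t = ℓ₀ - t := fun t ht ↦ hc_lo t ht.2.le
    have hρI4 : ∀ t ∈ Ioo (M / 4) (9 * M / 20), ρI t ≤ 4 * M := fun t ht ↦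
      rhoIso_le_four_mul hM ht.1.le (by linarith [ht.2])
    have hZ0 : ∀ t ∈ Ioo (M / 4) (9 * M / 20), 0 ≤ t := fun t ht ↦ by linarith [ht.1]
    have heq := zone2_eq hϱdef hτdef hνZ hν₂Z hcZ (fun t ↦ (hχb t).1) (fun t ↦ (hχb t).2) hρI4 hℓ4
      hZ0 hT4 hs
    have hder := zone2_hasDerivAt isOpen_Ioo hϱdef hτdef hνZ hν₂Z hcZ (fun t ↦ (hχb t).1)
      (fun t ↦ (hχb t).2) hρI4 hℓ4 hZ0 hT4 hs (hasDerivAt_rhoIso hs0.ne') (hasDerivAt_smoothStep (10 / M) (-3) s)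
    have hρs := hρI2 s hs0
    have hpos : 0 < ϱ s := by
      rw [heq.1]
      nlinarith [mul_nonneg (sub_nonneg.2 (hχb s).2) (sub_nonneg.2 hρs),
        mul_nonneg (hχb s).1 (show 0 ≤ ℓ₀ - s - 9 * M / 20 by linarith [hs.2]),
        mul_nonneg hM.le (sub_nonneg.2 (hχb s).2), mul_nonneg hM.le (hχb s).1]
    refine ⟨hpos, ?_⟩
    rw [hder.1.deriv, hder.2.deriv]
    refine radialA_pos_of_slice hM.le hpos (zone2_slope_neg ?_ (hχb s).1 (hχb s).2 ?_ ?_).ne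
    · have h1 : 2 * s - M < 0 := by linarith [hs.2]
      have h2 : 0 < 2 * s + M := by linarith
      exact div_neg_of_neg_of_pos (mul_neg_of_neg_of_pos h1 h2) (by positivity)
    · exact mul_nonneg Real.smoothTransition.monotone.deriv_nonneg (by positivity)
    · linarith
  -- Zone 3: `(2M/5, 51M/100)` (the corner)
  have hZ3 : ∀ s ∈ Ioo (2 * M / 5) (51 * M / 100),
      0 < ϱ s ∧ 0 < -(deriv τ s) ^ 2 + (deriv ϱ s) ^ 2 + 2 * M / ϱ s * (deriv τ s + deriv ϱ s) ^ 2 := by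
    intro s hs
    have hs0 : 0 < s := by linarith [hs.1]
    have hχZ : ∀ t ∈ Ioo (2 * M / 5) (51 * M / 100), χ t = 1 := fun t ht ↦ hχ1 t ht.1.le
    have hνZ : ∀ t ∈ Ioo (2 * M / 5) (51 * M / 100), ν t = 0 := fun t ht ↦ hν0 t (by linarith [ht.2])
    have hν₂Z : ∀ t ∈ Ioo (2 * M / 5) (51 * M / 100), ν₂ t = 0 := fun t ht ↦ hν₂0 t ht.2.le
    have hT0 : ∀ t ∈ Ioo (2 * M / 5) (51 * M / 100), T (ϱc t) = 0 := fun t ht ↦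
      hT4 _ (by have := hc4 t (by linarith [ht.1]) (by linarith [ht.2]); linarith)
    have heq := zone3_eq hϱdef hτdef hχZ hνZ hν₂Z hT0 hs
    have hder := zone3_hasDerivAt isOpen_Ioo hϱdef hτdef hχZ hνZ hν₂Z hT0 hs (hc_der s).1
    have hpos : 0 < ϱ s := by rw [heq.1]; have := hc_ge s; linarith
    refine ⟨hpos, ?_⟩
    rw [hder.1.deriv, hder.2.deriv]
    exact radialA_pos_of_corner hpos (by rw [heq.1]; exact hc4 s (by linarith [hs.1]) (by linarith [hs.2])) (hc_der s).2 rfl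
  -- Zone 4: `(M/2, 14M/25)`
  have hZ4 : ∀ s ∈ Ioo (M / 2) (14 * M / 25),
      0 < ϱ s ∧ 0 < -(deriv τ s) ^ 2 + (deriv ϱ s) ^ 2 + 2 * M / ϱ s * (deriv τ s + deriv ϱ s) ^ 2 := by
    intro s hs
    have hχZ : ∀ t ∈ Ioo (M / 2) (14 * M / 25), χ t = 1 := fun t ht ↦ hχ1 t (by linarith [ht.1])
    have hνZ : ∀ t ∈ Ioo (M / 2) (14 * M / 25), ν t = 0 := fun t ht ↦ hν0 t ht.2.le
    have hcZ : ∀ t ∈ Ioo (M / 2) (14 * M / 25), ϱc t = 9 * M / 40 + t / 2 := fun t ht ↦ hc_hi t ht.1.le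
    have hT0 : ∀ t ∈ Ioo (M / 2) (14 * M / 25), T (9 * M / 40 + t / 2) = 0 := fun t ht ↦
      hT4 _ (by linarith [ht.2])
    have hτhZ : ∀ t ∈ Ioo (M / 2) (14 * M / 25), τh (9 * M / 40 + t / 2) = 3 * (M - (9 * M / 40 + t / 2)) :=
      fun t ht ↦ hτh_line _ (by linarith [ht.2])
    have heq := zone4_eq hϱdef hτdef hχZ hνZ hcZ hT0 hτhZ hs
    have hder := zone4_hasDerivAt isOpen_Ioo hϱdef hτdef hχZ hνZ hcZ hT0 hτhZ hs
    have hpos : 0 < ϱ s := by rw [heq.1]; linarith [hs.1]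
    refine ⟨hpos, ?_⟩
    rw [hder.1.deriv, hder.2.deriv]
    exact radialA_pos_of_corner hpos (by rw [heq.1]; linarith [hs.2]) le_rfl (by norm_num)
  -- Zone 5: `(11M/20, M)`
  have hZ5 : ∀ s ∈ Ioo (11 * M / 20) M, (9 * M / 40 + s / 2 ≤ ϱ s ∧ ϱ s ≤ s) ∧ τ s = τh (ϱ s) ∧
      0 < ϱ s ∧ 0 < -(deriv τ s) ^ 2 + (deriv ϱ s) ^ 2 + 2 * M / ϱ s * (deriv τ s + deriv ϱ s) ^ 2 := by
    intro s hs
    have hχZ : ∀ t ∈ Ioo (11 * M / 20) M, χ t = 1 := fun t ht ↦ hχ1 t (by linarith [ht.1])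
    have hν₂Z : ∀ t ∈ Ioo (11 * M / 20) M, ν₂ t = 1 := fun t ht ↦ hν₂1 t ht.1.le
    have hcZ : ∀ t ∈ Ioo (11 * M / 20) M, ϱc t = 9 * M / 40 + t / 2 := fun t ht ↦ hc_hi t (by linarith [ht.1])
    have hZb : ∀ t ∈ Ioo (11 * M / 20) M, 9 * M / 20 < t ∧ t ≤ 4 * M := fun t ht ↦
      ⟨by linarith [ht.1], by linarith [ht.2]⟩
    have heq := zone5_eq hϱdef hτdef hχZ hν₂Z hcZ (fun t ↦ (hνb t).1) (fun t ↦ (hνb t).2) hZb hT4 hs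
    have hpos : 0 < ϱ s := by linarith [heq.2.1.1, hs.1]
    have hltM : ϱ s < M := lt_of_le_of_lt heq.2.1.2 hs.2
    obtain ⟨p, hτhd, hsteep⟩ := hasDerivAt_tauHat hM hpos hltM
    have hder := zone5_hasDerivAt isOpen_Ioo hϱdef hτdef hχZ hν₂Z hcZ (fun t ↦ (hνb t).1)
      (fun t ↦ (hνb t).2) hZb hT4 hs (hasDerivAt_smoothStep (25 / M) (-14) s)
      (mul_nonneg Real.smoothTransition.monotone.deriv_nonneg (by positivity)) hτhd
    refine ⟨heq.2.1, heq.2.2, hpos, ?_⟩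
    rw [hder.1.deriv, hder.2.2.deriv]
    exact radialA_pos_of_steep hpos (by linarith) (by linarith [hder.2.1]) hsteep
  -- assembly
  refine ⟨τ, ϱ, 51 * M / 20 - ℓ₀, hϱs, hτs, ?_, fun s hs ↦ (hZ1 s hs).1, ?_⟩
  · intro s hs
    rcases lt_or_ge s (3 * M / 10) with h1 | h1
    · exact (hZ1 s ⟨by linarith [hs.1], h1⟩).2
    rcases lt_or_ge s (9 * M / 20) with h2 | h2
    · exact hZ2 s ⟨by linarith, h2⟩
    rcases lt_or_ge s (51 * M / 100) with h3 | h3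
    · exact hZ3 s ⟨by linarith, h3⟩
    rcases lt_or_ge s (14 * M / 25) with h4 | h4
    · exact hZ4 s ⟨by linarith, h4⟩
    · exact (hZ5 s ⟨by linarith, by linarith [hs.2]⟩).2.2
  · intro s hs
    have h5 := hZ5 s ⟨by linarith [hs.1], hs.2⟩
    have hϱs' : ϱ s = s := by
      rw [hϱdef, hν1 s (by linarith [hs.1])]; ring
    refine ⟨hϱs', ?_⟩
    rw [h5.2.1, hϱs', hτh_out s hs.1.le hs.2.le]

end Exists

end Bridge

/-- **Registered export of this file** (sub-goal `bridge_profile` of stub `stub_bridgeAnnulus`): the bridge profile, `Bridge.exists_bridgeProfile`. [cite: ONeill1983, Ch. 13] -/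
theorem bridge_profile :
    ∀ (M : ℝ), 0 < M → ContDiff ℝ ∞ (Negative.bentHeight M 0) → ∃ τ ϱ : ℝ → ℝ, ∃ c : ℝ, ContDiffOn ℝ ∞ ϱ (Set.Ioi 0) ∧ ContDiffOn ℝ ∞ τ (Set.Ioi 0) ∧ (∀ s ∈ Set.Ioo (M / 40) (3 * M / 4), 0 < ϱ s ∧ 0 < -(deriv τ s) ^ 2 + (deriv ϱ s) ^ 2 + 2 * M / ϱ s * (deriv τ s + deriv ϱ s) ^ 2) ∧ (∀ s ∈ Set.Ioo 0 (3 * M / 10), ϱ s = (2 * s + M) ^ 2 / (4 * s) ∧ τ s = Negative.bentHeight M 0 ((2 * s + M) ^ 2 / (4 * s)) + c) ∧ (∀ s ∈ Set.Ioo (7 * M / 10) M, ϱ s = s ∧ τ s = 4 * M * Real.log (1 - s / (2 * M))) :=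
  fun _ hM hT ↦ Bridge.exists_bridgeProfile hM hT

end Summit.FinalStateConjecture.FinalStateConjecture.Theorems.SwallowTheDatum

end
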